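/-
Copyright (c) 2026 the pub-hodgecm-mathlib formalisation cell (harness21).  Prover seat hodgecm-mathlib-R90-C10-p02 (g2) (R90-TF SLAB, section S1 «Ch. 12 local»,
surplus hand on S1's last socket A2′ `stub_R90_122_keysThmTwo_ramifiedCharOne` = the K2E3 leaf (U4f-χ₁-ram-one), RULING R-S1-4; dealer of record K2E3-plan (g5)),
Track B «K2-LIT» ∕ h413 = `stmt-HodgeConjecture-24833`, line `K2_E3_EllipticInputs`, unit U4 «Keys», PART «U4Keys» socket :182 (U4f-χ₁-ram-one-pos)
`sig_K2E3KeysThmTwoContractingRamifiedCharOnePosDepth` (programme A_pos^{=} of K2E3-p37 (g0), memo `K2/K2E3-p37/g0/CENSUS-U4f-PosDepth.K2E3-p37-g0.md` §6–§10):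
brick §10 (c3) «THE ASSEMBLY» — BRANCH A OF KEYS' THEOREM AT POSITIVE DEPTH (sub-case A_pos^{=}), (G3)-explicit frame, big cell hypothesis-first.  REPORT-FIRST 2026-09-04.
-/
import Summits.HodgeConjecture.HodgeConjecture.Theorems.K2E3LevelNDepthWitnessCM             -- ★ p862149 §10 (b) (this seat): `exists_depthWitness_of_mem_map_of_not_mem` (letter `hwit` on the intermediate cells); brings ★ p862085 (a), ★ p861880, the (G3) frame
import Summits.HodgeConjecture.HodgeConjecture.Theorems.K2E3IwahoriLevelNLettersCM            -- ★ p861811 (K2E3-p37): `exists_iwahoriDatum_K_zero_eq_levelN` (the level-`n` datum), model `inf_pow_le_inf` (`J_n ≤ I`); brings ★ `K2E3BranchATypeLettersCM` (`theta_eq_tau_of_mem`, `theta_eq_one_of_map_mem`, `exists_mem_P_mul_of_mem`)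
import Summits.HodgeConjecture.HodgeConjecture.Theorems.K2E3BranchAContradictionCells         -- ★ p861573 (K2E3-p37): the cell-family engine `false_of_typeVector_of_integral_eq_zero_of_cells`
import Summits.HodgeConjecture.HodgeConjecture.Theorems.K2E3TypeVectorOfSubrepFactored         -- ★ V2b p858197 (K2E3-p06): `exists_typeVector_of_mem_of_factored`
import Summits.HodgeConjecture.HodgeConjecture.Theorems.K2E3IwahoriDatumDilation               -- ★ Z2A-2 p858273 (K2E3-p06): `exists_dilate_typeReady`
import Summits.HodgeConjecture.HodgeConjecture.Theorems.K2E3IntertwiningKernelOfReducible      -- ★ V1 p857640 (K2E3-p06): `exists_section_apply_one_ne_zero_forall_intertwiningIntegral_eq_zero`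
import Summits.HodgeConjecture.HodgeConjecture.Theorems.K2E3LowerUnipotentBigCellCM            -- ★ p862185 §10 (c1) (K2E3-p34): `exists_eq_borel_mul_weyl_mul_levelN_of_one_le_v` (the big cell at level `J_{m+1}`); brings ★ Z2A-3c (i) `K2E3BranchALettersCM` (`w₀_mul_w₀_mem`, `theta_conj_eq_one`)
import Summits.HodgeConjecture.HodgeConjecture.Theorems.K2E3BranchATorusWitnessLevelN           -- ★ p862140 §10 (c2) (K2E3-p34): `exists_torusWitness_levelN` (the Branch-A torus witness lies in `J_{m+1}`)
import HarnessLib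

/-!
# K2 ∕ E3 «EllipticInputs», unit U4 «Keys» — (U4f-χ₁-ram-one-pos), programme A_pos^{=} brick §10 (c3): BRANCH A OF KEYS' THEOREM AT POSITIVE DEPTH, ASSEMBLED
# «`χ₁` contracting, non-unitary, of conductor `m + 1 ≥ 2` with cond(`χ₁|_{F^×}`) = `m + 1`, `|2|_w = 1`, and `χ₁ ∘ N ≠ 1` on `𝒪ˣ` ⟹ `i(χ₁, 1)` is IRREDUCIBLE» on `U(Φ₃)(L⁺_v)`,
# `v` non-split, (G3)-explicit frame   [Keys1984 §3, §7 Thm (2); Casselman1995 §6.4; Roche1998 §3–§4; MoyPrasad1996 §3]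

Cell hodgecm-mathlib, Track B «K2-LIT», crux item H413 = stmt-HodgeConjecture-24833 (route `HCCMUnconditional`, no route verbs); target BY NAME the OPEN tier-0 leaf
`…K2E3EllipticInputs.U4Keys.sig_K2E3KeysThmTwoContractingRamifiedCharOnePosDepth` (U4Keys ED. 8 :182), design D-I «vanishing functional» at POSITIVE depth, sub-case A_pos^{=}
(cond(`χ₁|_{F^×}`) = cond `χ₁` = `m + 1`, `|2|_w = 1`).  Author R90-C10-p02 (g2) (S1 surplus hand, dealer of record K2E3-plan (g5); R0 composition signature posted
2026-09-04T16:51:15Z).  `--supports stmt-HodgeConjecture-24833 --as helper`; THEOREMS ONLY; (G3)-EXPLICIT frame of ★ p861811 `K2E3IwahoriLevelNLettersCM`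
(`L v w hw eA heA ϖ hϖ g₁ hg₁ K0 K1 I hK0 hK1 hI` + the level letters `gn hgn Jn hJn` at exponent `m + 1`) + `w₀ hw₀` + a Haar measure on `N(L⁺_v)` as in the depth-zero template
★ `K2E3BranchAIrreducibleDepthZero.false_of_reducible_of_normChar_ne_one`.  NOT THE PAYER of :182: sub-case A_pos^{=} only (A_pos^{<} needs Roche's asymmetric `J_χ`, memo §9;
B_pos = Keys (b)–(d) at positive depth is D59 (M1)–(M4)); the big cell is ★ p862185 (c1) `K2E3LowerUnipotentBigCellCM` and the torus witness ★ p862140 (c2)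
`K2E3BranchATorusWitnessLevelN`, both consumed BY NAME (K2E3-p34 (g2)); the frame-free LEAF wrapper (place-free letters, `w`, `ϖ`, `g₁`, `gn`, `eA` constructed, Haar on `N`)
is the next hand's file over THIS head (K2E3-p27 (g2), recipe 2026-09-04T21:29:30Z).

THE POINT.  Design D-I at level `J_{m+1}`: suppose `i(χ₁, 1)` reducible.  ★ V1 gives a `G`-stable `V ∋ f` with `f(1) ≠ 0` killed by `Λ_{w₀}`; ★ p861811 the Iwahori datum `𝓘`
with `𝓘.K 0 = J_{m+1}`, `𝓘.K 1 = I`, `𝓘.N̄ = eA⁻¹(N̄_w)`; ★ Z2A-2 a dilate of `f` in `V` fixed by `J_{m+1} ∩ N̄`; ★ V2b the `(J_{m+1}, θ)`-TYPE VECTOR `f′ ∈ V`, `f′(1) ≠ 0`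
(`hθmul` = ★ p861880 `theta_mul_pow` from the CONDUCTOR letter `hcond`; `hθH` = ★ `theta_eq_tau_of_mem` through `J_{m+1} ≤ I` (★ model `inf_pow_le_inf`); `hθC`, `hBC` as in
the template).  Then the CELL-FAMILY engine ★ p861573 with `B := J_{m+1}` and the family `R := {w₀} ∪ {r ∈ N̄ : |(eA r)₂₀|_w < 1, r ∉ J_{m+1}}`: the covering `hcells` is the
TRICHOTOMY «`w₀ n w₀ ∈ J_{m+1}`, or big cell `|z| ≥ 1` (`= h·w₀·b′`, ★ p862185 (c1)), or an intermediate representative `r = w₀ n w₀` itself»; the witnesses `hwit` are the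
level-`(m+1)` TORUS witness at `r = w₀` (★ p862140 (c2), Branch A: `χ₁(u·σu) ≠ 1` for a unit `u`) and ★ p862149 (b) `exists_depthWitness_of_mem_map_of_not_mem` at the
intermediate `r` (the EXACT-CONDUCTOR witness `u₁`: `σu₁ = u₁`, `u₁ ≡ 1 mod 𝔭ᵐ`, `χ₁ u₁ ≠ 1`); `hθ` = ★ `theta_conj_eq_one`; `hΛ` = V1.  Hence `False`.
* §1 `levelN_le_iwahori` (`J_{m+1} ≤ I` along `eA`).
* §2 (generic, any topological group) **`false_of_iwahoriDatum_of_cells`** — the ENGINE ASSEMBLY ★ Z2A-2 → ★ V2b → ★ p861573 over an Iwahori datum `𝓘` (`B = 𝓘.K 0`), a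
  `G`-stable `V ∋ f` with `f(1) ≠ 0`, a multiplicative `θ` agreeing with `τ` on `P ∩ B` and trivial on `B ∩ N̄`, a cell family `R` with witnesses and covering, and `Λ_w|_V = 0`
  (stated once in the `smoothIndRep` world so that the CM theorem pays the `cmPrincipalSeries` unification ONCE — the depth-zero template pays it four times).
* §3 **`false_of_reducible_of_posDepth_of_normChar_ne_one`** (frame + `w₀` + Haar; letters `hm h2 hcond u₁ hσu₁ hu₁ hχu₁ u hu hA`).
HONEST LABEL: HC_CM is proved only modulo the 7 printed citations (2 remaining named inputs: hLiu418 = stmt-HodgeConjecture-24832, h413 = stmt-HodgeConjecture-24833)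
until rung 0 closes; count-neutral — this file does NOT pay the leaf (A_pos^{=} only: exact conductor `m + 1` of `χ₁` AND of `χ₁|_{F^×}`, `|2|_w = 1`); no printed citation is discharged.

## References
* [Keys1984] D. Keys, *Principal series representations of special unitary groups over local fields*, Compositio Math. 51 (1984), §3, §7 Thm (2).
* [Casselman1995] W. Casselman, *Introduction to the theory of admissible representations of `p`-adic reductive groups* (1995), §6.3–§6.4.
* [Roche1998] A. Roche, *Types and Hecke algebras for principal series representations of split reductive p-adic groups*, Ann. Sci. ÉNS (4) 31 (1998), §3–§4.
* [MoyPrasad1996] A. Moy, G. Prasad, *Jacquet functors and unrefined minimal K-types*, Comment. Math. Helv. 71 (1996), §3.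
* [BruhatTits1972] F. Bruhat, J. Tits, *Groupes réductifs sur un corps local I*, Publ. Math. IHÉS 41 (1972), (4.4.4).
-/

set_option autoImplicit false
-- the mandated namespace has the single-problem summit's repeated segment (`HodgeConjecture.HodgeConjecture`)
set_option linter.dupNamespace false

noncomputable section

open NumberField IsDedekindDomain MeasureTheory
open scoped Matrix MatrixGroups WithZero Valued
open Literature.NumberTheory Literature.NumberTheory.Automorphic Literature.NumberTheory.Automorphic.UnitaryGroup
open Literature.NumberTheory.Rogawski1990

namespace Summit.HodgeConjecture.HodgeConjecture.Cruxes.H413.K2E3BranchAIrreduciblePosDepth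

open Summit.HodgeConjecture.HodgeConjecture.Cruxes.H413
open Summit.HodgeConjecture.HodgeConjecture.Cruxes.H413.K2E3DepthZeroIwahoriCharacterCM
open Summit.HodgeConjecture.HodgeConjecture.Cruxes.H413.K2E3BranchALettersCM
open Summit.HodgeConjecture.HodgeConjecture.Cruxes.H413.K2E3BranchATypeLettersCM
open Summit.HodgeConjecture.HodgeConjecture.Cruxes.H413.K2E3LevelNIwahoriCharacterCM

variable (L : Type) [Field L] [NumberField L] [IsCMField L] (v : HeightOneSpectrum (𝓞 ↥(maximalRealSubfield L)))
  (w : PlacesOver L v) (hw : IsCMField.complexConj L • w.1 = w.1)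
  (eA : Gqs L v ≃ₜ* ↥(unitaryGroupOfForm (galAdicCompletionMap (L := L) (IsCMField.complexConj L) hw) ((StdForm.antidiagonal 3).over (w.1.adicCompletion L))))
  (heA : ∀ g : Gqs L v,
    ((eA g : ↥(unitaryGroupOfForm (galAdicCompletionMap (L := L) (IsCMField.complexConj L) hw) ((StdForm.antidiagonal 3).over (w.1.adicCompletion L)))) :
        GL (Fin 3) (w.1.adicCompletion L)) =
      ((localNonsplitEquiv (IsCMField.complexConj L) (qsForm L) (IsCMField.complexConj_ne_one L) w hw g :
        ↥(unitaryGroupOfForm (galAdicCompletionMap (L := L) (IsCMField.complexConj L) hw) (placeForm (qsForm L) w.1))) : GL (Fin 3) (w.1.adicCompletion L)))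
  {ϖ : w.1.adicCompletion L} (hϖ : Valued.v ϖ = WithZero.exp (-1 : ℤ))
  (g₁ : GL (Fin 3) (w.1.adicCompletion L)) (hg₁ : (g₁ : Matrix (Fin 3) (Fin 3) (w.1.adicCompletion L)) = Matrix.diagonal ![(1 : w.1.adicCompletion L), 1, ϖ])
  (K0 K1 I : Subgroup (Gqs L v))
  (hK0 : K0 = ((glInt 3 (w.1.adicCompletion L)).subgroupOf
    (unitaryGroupOfForm (galAdicCompletionMap (L := L) (IsCMField.complexConj L) hw) ((StdForm.antidiagonal 3).over (w.1.adicCompletion L)))).comap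
      eA.toMulEquiv.toMonoidHom)
  (hK1 : K1 = (((glInt 3 (w.1.adicCompletion L)).map (MulAut.conj g₁).toMonoidHom).subgroupOf
    (unitaryGroupOfForm (galAdicCompletionMap (L := L) (IsCMField.complexConj L) hw) ((StdForm.antidiagonal 3).over (w.1.adicCompletion L)))).comap
      eA.toMulEquiv.toMonoidHom)
  (hI : I = K0 ⊓ K1)
  {m : ℕ} (gn : GL (Fin 3) (w.1.adicCompletion L))
  (hgn : (gn : Matrix (Fin 3) (Fin 3) (w.1.adicCompletion L)) = Matrix.diagonal ![(1 : w.1.adicCompletion L), 1, ϖ ^ (m + 1)])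
  (Jn : Subgroup (Gqs L v))
  (hJn : Jn = K0 ⊓ (((glInt 3 (w.1.adicCompletion L)).map (MulAut.conj gn).toMonoidHom).subgroupOf
    (unitaryGroupOfForm (galAdicCompletionMap (L := L) (IsCMField.complexConj L) hw) ((StdForm.antidiagonal 3).over (w.1.adicCompletion L)))).comap
      eA.toMulEquiv.toMonoidHom)

/-! ## §1 `J_{m+1} ≤ I` along `eA` -/

include hϖ hg₁ hK0 hK1 hI hgn hJn in
/-- **`J_{m+1} ≤ I`** (the comap along `eA` of the model inclusion ★ p861811 `inf_pow_le_inf`). [cite: BruhatTits1972, (4.4.4)] [cite: Roche1998, §3] -/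
theorem levelN_le_iwahori : Jn ≤ I := by
  have hvσ : ∀ x, Valued.v (galAdicCompletionMap (L := L) (IsCMField.complexConj L) hw x) = Valued.v x :=
    fun x => valued_galAdicCompletionMap (L := L) (IsCMField.complexConj L) hw x
  rw [hJn, hI, hK0, hK1, ← Subgroup.comap_inf, ← Subgroup.comap_inf]
  exact Subgroup.comap_mono (K2E3IwahoriLevelNLettersCM.inf_pow_le_inf (galAdicCompletionMap (L := L) (IsCMField.complexConj L) hw)
    (rfl : (StdForm.antidiagonal 3).over (w.1.adicCompletion L) = _) hvσ hϖ g₁ hg₁ gn hgn (by omega))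

/-! ## §2 Generic: the engine assembly over an Iwahori datum -/

section Generic

variable {G : Type*} [Group G] [TopologicalSpace G] [IsTopologicalGroup G]

/-- **THE BRANCH-A ENGINE ASSEMBLED OVER AN IWAHORI DATUM (generic).**  `t = (P, M, N)` a parabolic triple of a topological group `G`, `τ` a character-like representation of
`P` on `ℂ`, `𝓘` an Iwahori datum (`B := 𝓘.K 0` compact open with Iwahori factorisation), `N` closed with a Haar measure `μ`; `θ : G → ℂ` multiplicative on `B`, equal to
`τ(·)·1` on `P ∩ B` and to `1` on `B ∩ N̄`; a `G`-stable `V ∋ f` with `f(1) ≠ 0` on which the functional `Λ_w(f′) = ∫_N f′(w n w) dn` VANISHES; `w² ∈ B`; a cell family `R`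
with disagreement witnesses (`hwit`) covering `wNw` off `B` (`hcells`); `θ(w n w) = 1` on `B`.  Then `False`: ★ Z2A-2 `exists_dilate_typeReady` (a dilate of `f` in `V` fixed
by `B ∩ N̄`) → ★ V2b `exists_typeVector_of_mem_of_factored` (the `(B, θ)`-type vector `f′ ∈ V`, `f′(1) ≠ 0`; `hBC` from the datum's factorisation ★ `exists_mem_P_mul_of_mem`)
→ ★ p861573 `false_of_typeVector_of_integral_eq_zero_of_cells`. [cite: Casselman1995, §6.4] [cite: Roche1998, §3–§4] [cite: Keys1984, §3] -/
theorem false_of_iwahoriDatum_of_cells (t : ParabolicTriple G) (τ : Representation ℂ ↥t.P ℂ) (𝓘 : t.IwahoriDatum)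
    [MeasurableSpace ↥t.N] [BorelSpace ↥t.N] (μ : Measure ↥t.N) [μ.IsHaarMeasure] (hN : IsClosed (t.N : Set G))
    (θ : G → ℂ) (hθmul : ∀ x ∈ 𝓘.K 0, ∀ y ∈ 𝓘.K 0, θ (x * y) = θ x * θ y)
    (hθH : ∀ p (hp : p ∈ t.P), p ∈ 𝓘.K 0 → θ p = τ (⟨p, hp⟩ : ↥t.P) 1)
    (hθC : ∀ c ∈ 𝓘.K 0 ⊓ 𝓘.Nbar, θ c = 1)
    (V : Subrepresentation (Representation.smoothIndRep t.P τ)) (f : Representation.SmoothInd t.P τ) (hfV : f ∈ V) (hf1 : f.toFun 1 ≠ 0)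
    (w : G) (hw : w * w ∈ 𝓘.K 0) (R : Set G)
    (hwit : ∀ r ∈ R, ∃ b₀ ∈ 𝓘.K 0, ∃ hb₀H : r * b₀ * r⁻¹ ∈ t.P, θ b₀ ≠ τ (⟨r * b₀ * r⁻¹, hb₀H⟩ : ↥t.P) 1)
    (hcells : ∀ n : ↥t.N, w * (n : G) * w ∈ 𝓘.K 0 ∨ ∃ r ∈ R, ∃ h ∈ t.P, ∃ b' ∈ 𝓘.K 0, w * (n : G) * w = h * r * b')
    (hθ : ∀ n : ↥t.N, w * (n : G) * w ∈ 𝓘.K 0 → θ (w * (n : G) * w) = 1)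
    (hΛ : ∀ f', f' ∈ V → ∫ n : ↥t.N, f'.toFun (w * (n : G) * w) ∂μ = 0) : False := by
  -- ★ Z2A-2 at level `0`: a dilate of `f` inside `V`, non-zero at `1`, fixed by `B ∩ N̄`
  obtain ⟨i, hf₁V, hf₁1, hf₁fix⟩ := K2E3IwahoriDatumDilation.exists_dilate_typeReady t.P τ t 𝓘 t.M_le V f hfV hf1 0
  -- ★ V2b: the `(B, θ)`-type vector
  obtain ⟨f', hf'V, hf'1, heig⟩ := K2E3TypeVectorOfSubrepFactored.exists_typeVector_of_mem_of_factored t.P τ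
    (𝓘.K 0) (𝓘.K 0 ⊓ 𝓘.Nbar) (𝓘.isCompact_K 0) (fun b hb => exists_mem_P_mul_of_mem t 𝓘 0 hb)
    θ hθmul hθH (fun c hc _ => hθC c hc) V _ hf₁V hf₁1 (fun c hc _ => hf₁fix c hc)
  -- ★ p861573: the cell-family engine
  exact K2E3BranchAContradictionCells.false_of_typeVector_of_integral_eq_zero_of_cells t.P τ t.N (𝓘.K 0) μ hN (𝓘.isOpen_K 0) (𝓘.isCompact_K 0)
    w hw θ f' heig hf'1 R hwit hcells hθ (hΛ f' hf'V)

end Generic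

/-! ## §3 Branch A at positive depth: reducibility is impossible -/

open Classical in
include hw heA hϖ hg₁ hK0 hK1 hI hgn hJn in
set_option maxHeartbeats 1600000 in
set_option synthInstance.maxHeartbeats 400000 in
-- the Gqs-typed ★ letters ((b), (c1), (c2), Z2A-3c) meet the subtype-typed engine goals (instance unfolding); V1's witness is re-typed on arrival (see below)
/-- **BRANCH A OF KEYS' THEOREM AT POSITIVE DEPTH (design D-I, sub-case A_pos^{=}, assembled in the (G3) frame).**  `v` non-split; `χ₁` continuous, non-unitary, contracting,
of CONDUCTOR `≤ m + 1` (`hcond`, `1 ≤ m`); an EXACT-CONDUCTOR witness `u₁` (`σ`-fixed unit, `≡ 1 mod 𝔭ᵐ`, `χ₁ u₁ ≠ 1`: cond(`χ₁|_{F^×}`) = `m + 1`); `|2|_w = 1`; a unit `u` with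
`|u_{w′}| = 1` and `χ₁(u·σu) ≠ 1` (Branch A: `χ₁ ∘ N ≠ 1` on `𝒪ˣ`); `w₀` of matrix `Φ₃`; `μ` a Haar measure on `N(L⁺_v)`.  Then `i(χ₁, 1)` is NOT reducible: ★ V1 → ★ p861811
datum (`K 0 = J_{m+1}`) → ★ Z2A-2 → ★ V2b (`hθmul` ★ p861880 `theta_mul_pow`, `hθH` ★ `theta_eq_tau_of_mem` via §1) → ★ p861573 with `B := J_{m+1}`,
`R := {w₀} ∪ {r ∈ N̄ : |(eA r)₂₀| < 1, r ∉ J_{m+1}}`, `hwit` from ★ p862140 (c2) and ★ p862149 (b), `hcells` the trichotomy over ★ p862185 (c1), `hθ` ★ `theta_conj_eq_one`, `hΛ` V1.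
[cite: Keys1984, §3, §7 Thm (2)] [cite: Casselman1995, §6.4] [cite: Roche1998, §3–§4] [cite: MoyPrasad1996, §3] -/
theorem false_of_reducible_of_posDepth_of_normChar_ne_one
    (hns : ∀ w' : PlacesOver L v, IsCMField.complexConj L • w'.1 = w'.1)
    (χ₁ : (LocalRing L v)ˣ →* ℂˣ) (h₁ : Continuous fun x => ((χ₁ x : ℂˣ) : ℂ)) (hnu : ∃ x, ‖((χ₁ x : ℂˣ) : ℂ)‖ ≠ 1)
    (hcontr : ∀ x : (LocalRing L v)ˣ, unitModulusChar (LocalRing L v) x < 1 → ‖((χ₁ x : ℂˣ) : ℂ)‖ < 1)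
    (hm : 1 ≤ m) (h2 : Valued.v (2 : w.1.adicCompletion L) = 1)
    (hcond : ∀ u : (LocalRing L v)ˣ, (∀ w' : PlacesOver L v, Valued.v (((u : LocalRing L v) w') - 1) ≤ Valued.v ϖ ^ (m + 1)) → χ₁ u = 1)
    (u₁ : (LocalRing L v)ˣ) (hσu₁ : Units.map (conjLocal L (IsCMField.complexConj L) v : LocalRing L v →* LocalRing L v) u₁ = u₁)
    (hu₁ : ∀ w' : PlacesOver L v, Valued.v (((u₁ : LocalRing L v) w') - 1) ≤ Valued.v ϖ ^ m) (hχu₁ : χ₁ u₁ ≠ 1)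
    (u : (LocalRing L v)ˣ) (hu : ∀ w' : PlacesOver L v, Valued.v ((u : LocalRing L v) w') = 1)
    (hA : χ₁ (u * Units.map (conjLocal L (IsCMField.complexConj L) v : LocalRing L v →* LocalRing L v) u) ≠ 1)
    (w₀ : ↥(unitaryGroupOfForm (conjLocal L (IsCMField.complexConj L) v) (cmLocalForm L 3 v)))
    (hw₀ : Units.val (w₀ : GL (Fin 3) (LocalRing L v)) = cmLocalForm L 3 v)
    [MeasurableSpace ↥(cmBorelTriple L 3 v).N] [BorelSpace ↥(cmBorelTriple L 3 v).N] (μ : Measure ↥(cmBorelTriple L 3 v).N) [μ.IsHaarMeasure]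
    (hred : ∃ N : Subrepresentation (cmPrincipalSeries L 3 v (cmTorusCharPair L v χ₁ 1)), N ≠ ⊥ ∧ N ≠ ⊤) : False := by
  haveI := locallyCompactSpace_cmBorelU L 3 v
  have hJI : Jn ≤ I := levelN_le_iwahori L v w hw eA hϖ g₁ hg₁ K0 K1 I hK0 hK1 hI gn hgn Jn hJn
  -- `w₀² = 1` (★ `w₀_mul_w₀_mem` at the trivial subgroup)
  have hww : w₀ * w₀ = 1 := Subgroup.mem_bot.1 (w₀_mul_w₀_mem L v w hw eA heA ⊥ w₀ hw₀)
  have hwinv : w₀⁻¹ = w₀ := inv_eq_of_mul_eq_one_right hww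
  -- ★ V1: a `G`-stable `V ∋ f`, `f(1) ≠ 0`, killed by the intertwining functional `Λ_{w₀}`
  have h₂ : Continuous fun x : ↥(normOneUnits (conjLocal L (IsCMField.complexConj L) v)) =>
      (((1 : ↥(normOneUnits (conjLocal L (IsCMField.complexConj L) v)) →* ℂˣ) x : ℂˣ) : ℂ) := by
    simp only [MonoidHom.one_apply]; exact continuous_const
  -- (the witness is RE-TYPED in the generic `smoothIndRep` currency of §2 on arrival: `cmPrincipalSeries` unfolds to it, and doing the unfolding here,
  -- against a mvar-free target, keeps the §2 application below syntactic — the depth-zero template pays 16 M heartbeats for the same meeting)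
  obtain ⟨V, f, hfV, hf1, hΛ⟩ : ∃ (V : Subrepresentation (Representation.smoothIndRep (cmBorelTriple L 3 v).P
      (Representation.twist
      (((Representation.trivial ℂ ↥(torusU (conjLocal L (IsCMField.complexConj L) v) (cmLocalForm L 3 v)) ℂ).twist
        (cmTorusCharPair L v χ₁ 1)).comp (cmBorelTriple L 3 v).proj) (rootDeltaChar (cmBorelTriple L 3 v).P))))
      (f : Representation.SmoothInd (cmBorelTriple L 3 v).P
      (Representation.twist
      (((Representation.trivial ℂ ↥(torusU (conjLocal L (IsCMField.complexConj L) v) (cmLocalForm L 3 v)) ℂ).twist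
        (cmTorusCharPair L v χ₁ 1)).comp (cmBorelTriple L 3 v).proj) (rootDeltaChar (cmBorelTriple L 3 v).P))),
      f ∈ V ∧ f.toFun 1 ≠ 0 ∧ ∀ f', f' ∈ V → ∀ g : ↥(unitaryGroupOfForm (conjLocal L (IsCMField.complexConj L) v) (cmLocalForm L 3 v)),
        ∫ n : ↥(cmBorelTriple L 3 v).N, f'.toFun (w₀ * (n : ↥(unitaryGroupOfForm (conjLocal L (IsCMField.complexConj L) v) (cmLocalForm L 3 v))) * g) ∂μ = 0 :=
    K2E3IntertwiningKernelOfReducible.exists_section_apply_one_ne_zero_forall_intertwiningIntegral_eq_zero L v hns χ₁ 1 h₁ h₂ hnu hcontr hred w₀ hw₀ μ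
  -- ★ p862140 (c2): the level-`(m+1)` torus witness at `w₀`; ★ p862149 (b): the depth witnesses at the intermediate representatives
  obtain ⟨b₀, hb₀P, hb₀J, -, hne⟩ := K2E3BranchATorusWitnessLevelN.exists_torusWitness_levelN L v w hw eA heA hϖ g₁ hg₁ K0 K1 I hK0 hK1 hI gn hgn Jn hJn
    w₀ hw₀ χ₁ u hu hA
  have hwitI : ∀ r : Gqs L v, r ∈ ((cmBorelTriple L 3 v).N).map (MulAut.conj w₀).toMonoidHom →
      Valued.v ((((eA r : ↥(unitaryGroupOfForm (galAdicCompletionMap (L := L) (IsCMField.complexConj L) hw) ((StdForm.antidiagonal 3).over (w.1.adicCompletion L)))) :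
        GL (Fin 3) (w.1.adicCompletion L)) : Matrix (Fin 3) (Fin 3) (w.1.adicCompletion L)) 2 0) < 1 → r ∉ Jn →
      ∃ (b : Gqs L v) (hbP : ((r * b * r⁻¹ : Gqs L v) : ↥(unitaryGroupOfForm (conjLocal L (IsCMField.complexConj L) v) (cmLocalForm L 3 v))) ∈ (cmBorelTriple L 3 v).P),
        b ∈ Jn ∧
        (if h : IsUnit (((b.val : GL (Fin 3) (LocalRing L v)) : Matrix (Fin 3) (Fin 3) (LocalRing L v)) 0 0) then ((χ₁ h.unit : ℂˣ) : ℂ) else 0) ≠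
          (Representation.twist
              (((Representation.trivial ℂ ↥(torusU (conjLocal L (IsCMField.complexConj L) v) (cmLocalForm L 3 v)) ℂ).twist
                (cmTorusCharPair L v χ₁ 1)).comp (cmBorelTriple L 3 v).proj) (rootDeltaChar (cmBorelTriple L 3 v).P))
            ⟨((r * b * r⁻¹ : Gqs L v) : ↥(unitaryGroupOfForm (conjLocal L (IsCMField.complexConj L) v) (cmLocalForm L 3 v))), hbP⟩ 1 :=
    fun r hr hz hoff => K2E3LevelNDepthWitnessCM.exists_depthWitness_of_mem_map_of_not_mem L v w hw eA heA hϖ K0 hK0 gn hgn Jn hJn w₀ hw₀ hm h2 χ₁ hcond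
      u₁ hσu₁ hu₁ hχu₁ hr hz hoff
  -- §1 of ★ p861811: the Iwahori datum with `K 0 = J_{m+1}`, `K 1 = I`, `N̄ = eA⁻¹(N̄_w)`
  obtain ⟨𝓘, hK0J, -, hNbar⟩ := K2E3IwahoriLevelNLettersCM.exists_iwahoriDatum_K_zero_eq_levelN L v w hw eA heA hϖ g₁ hg₁ K0 K1 I hK0 hK1 hI gn hgn Jn hJn
    (by omega)
  subst hK0J
  -- §2 with `B := J_{m+1}`, `θ(g) = χ₁(unit g₀₀)`, `R := {w₀} ∪ {intermediate representatives}`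
  refine false_of_iwahoriDatum_of_cells (cmBorelTriple L 3 v)
    (Representation.twist
      (((Representation.trivial ℂ ↥(torusU (conjLocal L (IsCMField.complexConj L) v) (cmLocalForm L 3 v)) ℂ).twist
        (cmTorusCharPair L v χ₁ 1)).comp (cmBorelTriple L 3 v).proj) (rootDeltaChar (cmBorelTriple L 3 v).P)) 𝓘 μ
    (LineRing.isClosed_unipotentU (conjLocal L (IsCMField.complexConj L) v) (cmLocalForm L 3 v))
    (fun g : ↥(unitaryGroupOfForm (conjLocal L (IsCMField.complexConj L) v) (cmLocalForm L 3 v)) =>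
      if h : IsUnit (((g : GL (Fin 3) (LocalRing L v)) : Matrix (Fin 3) (Fin 3) (LocalRing L v)) 0 0) then ((χ₁ h.unit : ℂˣ) : ℂ) else 0)
    (fun x hx y hy => theta_mul_pow L v w hw eA heA hϖ K0 hK0 gn hgn (𝓘.K 0) hJn (by omega) χ₁ hcond hx hy)
    (fun p hp hpJ => theta_eq_tau_of_mem L v w hw eA heA hϖ g₁ hg₁ K0 K1 I hK0 hK1 hI χ₁ p hp (hJI hpJ))
    (fun c hc => theta_eq_one_of_map_mem L v w hw eA heA χ₁ (by
      have h := (Subgroup.mem_inf.1 hc).2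
      rw [hNbar] at h
      exact h))
    V f hfV hf1 w₀ (by rw [hww]; exact Subgroup.one_mem _)
    ({w₀} ∪ {r : ↥(unitaryGroupOfForm (conjLocal L (IsCMField.complexConj L) v) (cmLocalForm L 3 v)) |
      r ∈ ((cmBorelTriple L 3 v).N).map (MulAut.conj w₀).toMonoidHom ∧
      Valued.v ((((eA r : ↥(unitaryGroupOfForm (galAdicCompletionMap (L := L) (IsCMField.complexConj L) hw) ((StdForm.antidiagonal 3).over (w.1.adicCompletion L)))) :
        GL (Fin 3) (w.1.adicCompletion L)) : Matrix (Fin 3) (Fin 3) (w.1.adicCompletion L)) 2 0) < 1 ∧ r ∉ 𝓘.K 0})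
    ?_ ?_ (fun n _ => theta_conj_eq_one L v w hw eA heA (cmBorelTriple L 3 v) rfl w₀ hw₀ χ₁ n.2) (fun f' hf'V => hΛ f' hf'V w₀)
  · -- `hwit`: the torus witness at `w₀` (★ p862140), ★ p862149 (b) at an intermediate representative
    rintro r (hr | ⟨hr, hz, hoff⟩)
    · rw [Set.mem_singleton_iff] at hr
      subst hr
      exact ⟨b₀, hb₀J, hb₀P, hne⟩
    · obtain ⟨b, hbP, hbJ, hne'⟩ := hwitI r hr hz hoff
      exact ⟨b, hbJ, hbP, hne'⟩
  · -- `hcells`: the trichotomy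
    intro n
    by_cases hJ : w₀ * (n : ↥(unitaryGroupOfForm (conjLocal L (IsCMField.complexConj L) v) (cmLocalForm L 3 v))) * w₀ ∈ 𝓘.K 0
    · exact Or.inl hJ
    right
    by_cases hz : 1 ≤ Valued.v ((((eA (w₀ * (n : ↥(unitaryGroupOfForm (conjLocal L (IsCMField.complexConj L) v) (cmLocalForm L 3 v))) * w₀) :
        ↥(unitaryGroupOfForm (galAdicCompletionMap (L := L) (IsCMField.complexConj L) hw) ((StdForm.antidiagonal 3).over (w.1.adicCompletion L)))) :
          GL (Fin 3) (w.1.adicCompletion L)) : Matrix (Fin 3) (Fin 3) (w.1.adicCompletion L)) 2 0)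
    · -- ★ p862185 (c1): the big cell `w₀ n w₀ = h · w₀ · b′`
      obtain ⟨h, hh, b', hb', e⟩ := K2E3LowerUnipotentBigCellCM.exists_eq_borel_mul_weyl_mul_levelN_of_one_le_v L v w hw eA heA hϖ K0 hK0 gn hgn (𝓘.K 0) hJn
        (cmBorelTriple L 3 v) rfl w₀ hw₀ n.2 hz
      exact ⟨w₀, Set.mem_union_left _ (Set.mem_singleton w₀), h, hh, b', hb', e⟩
    · -- an intermediate representative: `r := w₀ n w₀` itself, `h = b′ = 1`
      have hmem : w₀ * (n : ↥(unitaryGroupOfForm (conjLocal L (IsCMField.complexConj L) v) (cmLocalForm L 3 v))) * w₀ ∈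
          ((cmBorelTriple L 3 v).N).map (MulAut.conj w₀).toMonoidHom :=
        Subgroup.mem_map.2 ⟨n, n.2, by rw [MulEquiv.coe_toMonoidHom, MulAut.conj_apply, hwinv]⟩
      refine ⟨w₀ * (n : ↥(unitaryGroupOfForm (conjLocal L (IsCMField.complexConj L) v) (cmLocalForm L 3 v))) * w₀, Set.mem_union_right _ ?_, 1, Subgroup.one_mem _, 1, Subgroup.one_mem _,
        by rw [one_mul, mul_one]⟩
      rw [Set.mem_setOf_eq]
      exact ⟨hmem, not_le.1 hz, hJ⟩

end Summit.HodgeConjecture.HodgeConjecture.Cruxes.H413.K2E3BranchAIrreduciblePosDepth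

end
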